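import Literature.NumberTheory.EllipticCurves.KubertTateFiveVeluKernel
import Literature.NumberTheory.EllipticCurves.X1ElevenMordellWeil
import Literature.NumberTheory.EllipticCurves.MordellWeilModNCard
import HarnessLib

/-!
# The rational `5`-power torsion of the Kubert–Tate curves `E_{m,n}` is `⟨T⟩`
# (reduction modulo a small good prime `q ∈ {2, 3, 7, 11}`)

PROOF-ONLY file (theorems only, no definition, no named fact, no `sorry`), topic
`NumberTheory/EllipticCurves`; the GENERIC form (parameters `m n : ℤ`) of `KubertTate1314Torsion`
(which treats `(m, n) = (13, 14)` by reduction modulo `3`). For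

  `E = E_{m,n} = kubertTateFive m n : y² + (n - m)xy - mn²y = x³ - mnx²`

over `ℚ` (elliptic; `Δ = m⁵n⁵(m² - 11mn - n²)`, `T = (0,0)` of order `5`) and a prime `q ≠ 5` of good
reduction with `2q + 1 < 25`, i.e. `q ∈ {2, 3, 7, 11}` and `q ∤ Δ`:

* `natCard_le_of_not_dvd` — a finite subgroup `B ≤ E(ℚ)` of order prime to `q` has `#B ≤ 2q + 1`
  (reduction modulo `q` is injective on it, Silverman VII.3.1(b), via the tree's
  `X1Eleven.natCard_le_of_hasNonsingularReduction`, and `#Ẽ(𝔽_q) ≤ 2q + 1`);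
* **`torsionBy_twentyfive_eq`** — `E(ℚ)[25] = ⟨T⟩` (a `5`-group of order `≤ 2q + 1 < 25` containing
  `⟨T⟩ ≅ ℤ/5`); `natCard_torsionBy_five : #E(ℚ)[5] = 5`;
* **`twentyfive_nsmul_ne_zero`** — a rational affine point `P = (x, y)` with `x ∉ {0, mn}` has
  `25 P ≠ O` (and `twentyfive_zsmul_toGeomPoints_ne_zero`: the same for its image in `E(ℚ̄)`, the
  shape `((25 : ℕ) : ℤ) • P₁ ≠ 0` of the reference-point hypothesis of the `μ₅`-descent engine
  `KubertTateMuDescent`).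

These discharge, by `norm_num` on `Δ`, the two arithmetic inputs (`#E(ℚ)[5] = 5`, `25 P₁ ≠ O`) of an
instance of the `5`-descent box criterion on the family.

## References

* [SilvermanAEC2009] J. H. Silverman, *AEC*, 2nd ed., VII.3 Prop. 3.1(b), VIII.§1, Exercise 10.1.
* [Kubert1976] D. S. Kubert, *Universal bounds on the torsion of elliptic curves*, Table 3 (`N = 5`).
* [Knapp1993] A. W. Knapp, *Elliptic Curves*, §V.5 (5.31).
-/

noncomputable section

open scoped Classical
open WeierstrassCurve Field
open Literature.NumberTheory.EllipticCurves Literature.NumberTheory.EllipticCurves.KubertTateKummer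
  Literature.NumberTheory.EllipticCurves.KubertTateVelu

namespace Literature.NumberTheory.EllipticCurves

namespace KubertTateFiveTorsion

/-- Arithmetic of the final count (kept outside the classical sections: `omega` is kernel-safe here).
[folklore] -/
private theorem five_mul_le_five {c b : ℕ} (hle : 5 * c ≤ b) (hb : b < 25) (h2 : ¬ 2 ∣ 5 * c)
    (h3 : ¬ 3 ∣ 5 * c) : 5 * c ≤ 5 := by omega

/-! ## Part A. Reduction modulo a good prime `q` -/

section Padic

/- `E(ℚ)` with the classical `DecidableEq ℚ`, as in the generic isogeny library and in the
`μ₅`-descent engine `KubertTateMuDescent` (the consumer of this file). -/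
attribute [local instance 10000] Classical.propDecidable

variable (m n : ℤ) (q : ℕ) [Fact q.Prime]

/-- `E_{m,n} ⊗ ℚ_q` is the base change of the `ℤ_q`-integral equation `kubertTateFive m n`.
[cite: Kubert1976, Table 3 (N = 5)] -/
theorem baseChange_padic_eq :
    (kubertTateFive (m : ℚ) (n : ℚ)).baseChange ℚ_[q] =
      (kubertTateFive (m : ℤ_[q]) (n : ℤ_[q])).baseChange ℚ_[q] := by
  simp only [WeierstrassCurve.baseChange, map_kubertTateFive, map_intCast]

/-- `Δ(E_{m,n})` over `ℤ_q` is the integer `Δ(E_{m,n})`. [cite: Kubert1976, Table 3 (N = 5)] -/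
theorem Δ_padicInt_eq :
    (kubertTateFive (m : ℤ_[q]) (n : ℤ_[q])).Δ = (((kubertTateFive m n).Δ : ℤ) : ℤ_[q]) := by
  have e : kubertTateFive (m : ℤ_[q]) (n : ℤ_[q]) = (kubertTateFive m n).map (Int.castRingHom ℤ_[q]) := by
    rw [map_kubertTateFive]; simp
  rw [e, map_Δ]; simp

/-- `E_{m,n}` has good reduction at a prime `q ∤ Δ`: `Δ ∈ ℤ_qˣ`. [cite: SilvermanAEC2009, VII.§5 Prop. 5.1] -/
theorem isUnit_Δ_padicInt (hq : ¬ (q : ℤ) ∣ (kubertTateFive m n).Δ) :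
    IsUnit (kubertTateFive (m : ℤ_[q]) (n : ℤ_[q])).Δ := by
  rw [Δ_padicInt_eq, PadicInt.isUnit_iff]
  refine le_antisymm (PadicInt.norm_le_one _) (not_lt.mp fun hlt => hq ?_)
  exact (PadicInt.norm_int_lt_one_iff_dvd (p := q) _).mp hlt

/-- **Finite subgroups of `E_{m,n}(ℚ)` of order prime to a good prime `q` have order `≤ 2q + 1`**
(reduction modulo `q` is injective on them, Silverman VII.3.1(b), and `#Ẽ(𝔽_q) ≤ 2q + 1`; the device
of the tree's `X1Eleven.natCard_le_of_not_dvd`). [cite: SilvermanAEC2009, VII.3 Prop. 3.1(b)] -/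
theorem natCard_le_of_not_dvd (hq : ¬ (q : ℤ) ∣ (kubertTateFive m n).Δ)
    (B : AddSubgroup (kubertTateFive (m : ℚ) (n : ℚ)).toAffine.Point) [Finite B]
    (hB : ¬ q ∣ Nat.card B) : Nat.card B ≤ 2 * q + 1 := by
  have hv := integers_valuationRing_valuation ℤ_[q] ℚ_[q]
  have hW := baseChange_padic_eq m n q
  set ι : (kubertTateFive (m : ℚ) (n : ℚ)).toAffine.Point →+
      ((kubertTateFive (m : ℤ_[q]) (n : ℤ_[q])).baseChange ℚ_[q]).toAffine.Point :=
    (Affine.Point.congrEquiv hW).toAddMonoidHom.comp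
      (Affine.Point.map (W' := (kubertTateFive (m : ℚ) (n : ℚ)).toAffine) (S := ℚ)
        (Algebra.ofId ℚ ℚ_[q])) with hι
  have hιinj : Function.Injective ι :=
    (Affine.Point.congrEquiv hW).injective.comp
      (Affine.Point.map_injective (W' := (kubertTateFive (m : ℚ) (n : ℚ)).toAffine)
        (f := Algebra.ofId ℚ ℚ_[q]))
  set B' := B.map ι with hB'
  have hcardB' : Nat.card B' = Nat.card B :=
    (Nat.card_congr (B.equivMapOfInjective ι hιinj).toEquiv).symm
  haveI : Finite (IsLocalRing.ResidueField ℤ_[q]) :=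
    Finite.of_equiv (ZMod q) (PadicInt.residueField (p := q)).symm.toEquiv
  haveI : Fintype (IsLocalRing.ResidueField ℤ_[q]) := Fintype.ofFinite _
  haveI : Finite ((kubertTateFive (m : ℤ_[q]) (n : ℤ_[q])).map
      (IsLocalRing.residue ℤ_[q])).toAffine.Point := finite_point _
  have hns : ∀ P ∈ B', (kubertTateFive (m : ℤ_[q]) (n : ℤ_[q])).HasNonsingularReduction P :=
    fun P _ => hasNonsingularReduction_of_isUnit_Δ hv (isUnit_Δ_padicInt m n q hq) P
  have hkill : ∀ P ∈ B', ((Nat.card B : ℕ) : ℤ) • P = 0 := by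
    rintro _ ⟨Q, hQ, rfl⟩
    have h1 : (Nat.card B • (⟨Q, hQ⟩ : B) : B) = 0 := card_nsmul_eq_zero'
    have h2 : Nat.card B • Q = 0 := by
      have h1' := congrArg Subtype.val h1
      rwa [AddSubmonoidClass.coe_nsmul, ZeroMemClass.coe_zero] at h1'
    rw [natCast_zsmul, ← map_nsmul, h2, map_zero]
  have hn : ValuationRing.valuation ℤ_[q] ℚ_[q] (((Nat.card B : ℕ) : ℤ) : ℚ_[q]) = 1 :=
    X1Eleven.valuation_natCast_eq_one q hB
  calc Nat.card B = Nat.card B' := hcardB'.symm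
    _ ≤ Nat.card ((kubertTateFive (m : ℤ_[q]) (n : ℤ_[q])).map
          (IsLocalRing.residue ℤ_[q])).toAffine.Point :=
        X1Eleven.natCard_le_of_hasNonsingularReduction hv B' hns hn hkill
    _ ≤ 2 * Fintype.card (IsLocalRing.ResidueField ℤ_[q]) + 1 :=
        natCard_point_le_two_mul_card_add_one' _
    _ = 2 * q + 1 := by rw [← Nat.card_eq_fintype_card, natCard_residueField_padicInt]

end Padic

end KubertTateFiveTorsion

end Literature.NumberTheory.EllipticCurves

-- The `ℚ`-algebra diamond on `AlgebraicClosure ℚ` (`DivisionRing.toRatAlgebra` vs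
-- `AlgebraicClosure.instAlgebra`): `geomPoints`, the Galois action and the tree's Kummer theory are
-- keyed on the latter (same device as `KubertTate1314Torsion`).
attribute [-instance] DivisionRing.toRatAlgebra

namespace Literature.NumberTheory.EllipticCurves

namespace KubertTateFiveTorsion

/-! ## Part B. `E(ℚ) → E(ℚ̄)`; the rational `5`-power torsion is `⟨T⟩` -/

section Geom

attribute [local instance 10000] Classical.propDecidable

variable (m n : ℤ) [hE : (kubertTateFive (m : ℚ) (n : ℚ)).IsElliptic]

/-- `T = (0, 0)` is a nonsingular rational point of `E_{m,n}` (`mn² ≠ 0`). [cite: Knapp1993, §V.5 (5.31)] -/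
theorem nonsingular_zero : (kubertTateFive (m : ℚ) (n : ℚ)).toAffine.Nonsingular 0 0 := by
  obtain ⟨hm0, hn0, -⟩ := ne_zero_of_isElliptic (m : ℚ) (n : ℚ)
  exact (kubertTateFive_nonsingular_zero_iff (m : ℚ) (n : ℚ)).mpr (mul_ne_zero hm0 (pow_ne_zero 2 hn0))

omit hE in
/-- `ι_*` of a rational affine point of `E_{m,n}` is the point of `E(ℚ̄)` with the same coordinates.
[cite: SilvermanAEC2009, VIII.§1] -/
theorem toGeomPoints_some {x y : ℚ} (h : (kubertTateFive (m : ℚ) (n : ℚ)).toAffine.Nonsingular x y) :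
    ∃ h', toGeomPoints (kubertTateFive (m : ℚ) (n : ℚ)) (.some x y h) =
      .some (algebraMap ℚ (AlgebraicClosure ℚ) x) (algebraMap ℚ (AlgebraicClosure ℚ) y) h' :=
  ⟨_, Affine.Point.map_some (W' := (kubertTateFive (m : ℚ) (n : ℚ)).toAffine)
    (Algebra.ofId ℚ (AlgebraicClosure ℚ)) h⟩

/-- Two affine points with equal coordinates are equal (proof-irrelevant form). [folklore] -/
private theorem some_eq_some_of_eq {R : Type*} [CommRing R] {V : WeierstrassCurve R}
    {x y x' y' : R} (hx : x = x') (hy : y = y') (h : V.toAffine.Nonsingular x y)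
    (h' : V.toAffine.Nonsingular x' y') : Affine.Point.some x y h = Affine.Point.some x' y' h' := by
  subst hx hy; rfl

/-- `ι_* T = T̄ = KubertTateKummer.Tbar m n`. [cite: Kubert1976, Table 3 (N = 5)] -/
theorem toGeomPoints_T : toGeomPoints (kubertTateFive (m : ℚ) (n : ℚ))
    (.some 0 0 (nonsingular_zero m n)) = Tbar (m : ℚ) (n : ℚ) := by
  obtain ⟨h', e⟩ := toGeomPoints_some m n (nonsingular_zero m n)
  rw [e, Tbar_eq]
  exact some_eq_some_of_eq (map_zero _) (map_zero _) _ _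

/-- **`T = (0,0)` has order `5` in `E_{m,n}(ℚ)`.** [cite: Kubert1976, Table 3 (N = 5)] -/
theorem addOrderOf_T : addOrderOf (Affine.Point.some 0 0 (nonsingular_zero m n) :
    (kubertTateFive (m : ℚ) (n : ℚ)).toAffine.Point) = 5 := by
  have h := addOrderOf_injective (toGeomPoints (kubertTateFive (m : ℚ) (n : ℚ)))
    (toGeomPoints_injective (kubertTateFive (m : ℚ) (n : ℚ))) (Affine.Point.some 0 0 (nonsingular_zero m n))
  rw [toGeomPoints_T, addOrderOf_Tbar] at h
  exact h.symm

/-- `5 T = O`. [cite: Kubert1976, Table 3 (N = 5)] -/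
theorem five_nsmul_T : (5 : ℕ) • (Affine.Point.some 0 0 (nonsingular_zero m n) :
    (kubertTateFive (m : ℚ) (n : ℚ)).toAffine.Point) = 0 := by
  rw [← addOrderOf_T m n]; exact addOrderOf_nsmul_eq_zero _

/-- An affine rational point in `⟨T⟩` has `x ∈ {0, mn}` (`±T = (0, ·)`, `±2T = (mn, ·)`).
[cite: Knapp1993, §V.5 (5.30)] -/
theorem x_eq_of_mem_zmultiples_T {x y : ℚ} {h : (kubertTateFive (m : ℚ) (n : ℚ)).toAffine.Nonsingular x y}
    (hP : Affine.Point.some x y h ∈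
      AddSubgroup.zmultiples (Affine.Point.some 0 0 (nonsingular_zero m n))) :
    x = 0 ∨ x = m * n := by
  obtain ⟨k, hk⟩ := AddSubgroup.mem_zmultiples_iff.mp hP
  have hmem : toGeomPoints (kubertTateFive (m : ℚ) (n : ℚ)) (.some x y h) ∈
      AddSubgroup.zmultiples (Tbar (m : ℚ) (n : ℚ)) := by
    rw [← hk, map_zsmul, toGeomPoints_T]
    exact AddSubgroup.zsmul_mem _ (AddSubgroup.mem_zmultiples _) k
  obtain ⟨h', e⟩ := toGeomPoints_some m n h
  rw [e] at hmem
  rcases eq_zero_or_x_mem_of_mem_zmultiples (m : ℚ) (n : ℚ) hmem with h0 | ⟨x', y', h'', hP', hx'⟩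
  · exact absurd h0 (Affine.Point.some_ne_zero _)
  · have hx : algebraMap ℚ (AlgebraicClosure ℚ) x = x' := by injection hP'
    rcases hx' with rfl | rfl
    · exact Or.inl ((map_eq_zero_iff _ (algebraMap ℚ (AlgebraicClosure ℚ)).injective).mp hx)
    · exact Or.inr ((algebraMap ℚ (AlgebraicClosure ℚ)).injective hx)

/-- **Mordell–Weil for `E_{m,n}`** (tree theorem `module_finite_point_holds`, for this file's
`DecidableEq ℚ` instance of the group law). [cite: SilvermanAEC2009, Thm. VIII.6.7] -/
theorem moduleFinite_point : Module.Finite ℤ (kubertTateFive (m : ℚ) (n : ℚ)).toAffine.Point := by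
  convert module_finite_point_holds (kubertTateFive (m : ℚ) (n : ℚ))

variable (q : ℕ) [Fact q.Prime] (hq5 : q ≠ 5) (hq11 : 2 * q + 1 < 25)
  (hq : ¬ (q : ℤ) ∣ (kubertTateFive m n).Δ)

include hq5 hq11 hq in
/-- **The rational `25`-torsion of `E_{m,n}` is `⟨T⟩`** when some prime `q ∈ {2, 3, 7, 11}` is of good
reduction: `E(ℚ)[25]` is a `5`-group, so of order prime to `q`, hence of order `≤ 2q + 1 < 25` by
reduction modulo `q`, and it contains `⟨T⟩` of order `5`. [cite: SilvermanAEC2009, VII.3 Prop. 3.1(b)] -/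
theorem torsionBy_twentyfive_eq :
    AddSubgroup.torsionBy (kubertTateFive (m : ℚ) (n : ℚ)).toAffine.Point ((25 : ℕ) : ℤ) =
      AddSubgroup.zmultiples (Affine.Point.some 0 0 (nonsingular_zero m n)) := by
  set B := AddSubgroup.torsionBy (kubertTateFive (m : ℚ) (n : ℚ)).toAffine.Point ((25 : ℕ) : ℤ) with hB
  haveI := moduleFinite_point m n
  -- `B` is finite (Mordell–Weil)
  haveI : Finite B := finite_torsionBy_of_moduleFinite (kubertTateFive (m : ℚ) (n : ℚ)).toAffine.Point 25
  -- a prime `ℓ ≠ 5` does not divide `#B`: an element of order `ℓ` would have order dividing `25`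
  have hℓ : ∀ ℓ : ℕ, ℓ.Prime → ℓ ≠ 5 → ¬ ℓ ∣ Nat.card B := by
    intro ℓ hℓ hℓ5 hdvd
    haveI : Fact ℓ.Prime := ⟨hℓ⟩
    obtain ⟨g, hg⟩ := exists_prime_addOrderOf_dvd_card' ℓ hdvd
    have hg25 : (25 : ℕ) • (g : (kubertTateFive (m : ℚ) (n : ℚ)).toAffine.Point) = 0 :=
      AddSubgroup.torsionBy.nsmul_iff.mp g.2
    have hdvd' : addOrderOf (g : (kubertTateFive (m : ℚ) (n : ℚ)).toAffine.Point) ∣ 25 :=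
      addOrderOf_dvd_of_nsmul_eq_zero hg25
    rw [AddSubgroup.addOrderOf_coe, hg] at hdvd'
    have h25 : (25 : ℕ) = 5 ^ 2 := rfl
    rw [h25, Nat.dvd_prime_pow Nat.prime_five] at hdvd'
    obtain ⟨i, hi2, hi⟩ := hdvd'
    have hℓ1 : ℓ ≠ 1 := hℓ.one_lt.ne'
    interval_cases i
    · exact hℓ1 (by simpa using hi)
    · exact hℓ5 (by simpa using hi)
    · rw [hi] at hℓ; exact absurd hℓ (by norm_num)
  have hle' := natCard_le_of_not_dvd m n q hq B (hℓ q Fact.out hq5)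
  have h2 := hℓ 2 Nat.prime_two (by norm_num)
  have h3 := hℓ 3 Nat.prime_three (by norm_num)
  -- `⟨T⟩ ≤ B`, `#⟨T⟩ = 5`
  have hle : AddSubgroup.zmultiples (Affine.Point.some 0 0 (nonsingular_zero m n)) ≤ B := by
    rw [AddSubgroup.zmultiples_le, hB]
    apply AddSubgroup.torsionBy.nsmul_iff.mpr
    rw [show (25 : ℕ) = 5 * 5 from rfl, mul_nsmul, five_nsmul_T, nsmul_zero]
  have hT5 : Nat.card (AddSubgroup.zmultiples (Affine.Point.some 0 0 (nonsingular_zero m n) :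
      (kubertTateFive (m : ℚ) (n : ℚ)).toAffine.Point)) = 5 := by
    rw [Nat.card_zmultiples, addOrderOf_T]
  have hdvd : 5 ∣ Nat.card B := hT5 ▸ AddSubgroup.card_dvd_of_le hle
  refine (AddSubgroup.eq_of_le_of_card_ge hle ?_).symm
  rw [hT5]
  obtain ⟨c, hc⟩ := hdvd
  rw [hc] at hle' h2 h3 ⊢
  exact five_mul_le_five hle' hq11 h2 h3

include hq5 hq11 hq in
/-- The rational `5`-torsion is `⟨T⟩`, of order `5`: **`#E_{m,n}(ℚ)[5] = 5`** (given a good prime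
`q ∈ {2, 3, 7, 11}`). [cite: Kubert1976, Table 3 (N = 5)] -/
theorem natCard_torsionBy_five :
    Nat.card (AddSubgroup.torsionBy (kubertTateFive (m : ℚ) (n : ℚ)).toAffine.Point ((5 : ℕ) : ℤ)) = 5 := by
  have h : AddSubgroup.torsionBy (kubertTateFive (m : ℚ) (n : ℚ)).toAffine.Point ((5 : ℕ) : ℤ) =
      AddSubgroup.zmultiples (Affine.Point.some 0 0 (nonsingular_zero m n)) := by
    refine le_antisymm ?_ ?_
    · rw [← torsionBy_twentyfive_eq m n q hq5 hq11 hq]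
      intro P hP
      have hP' : (5 : ℕ) • P = 0 := AddSubgroup.torsionBy.nsmul_iff.mp hP
      apply AddSubgroup.torsionBy.nsmul_iff.mpr
      rw [show (25 : ℕ) = 5 * 5 from rfl, mul_nsmul, hP', nsmul_zero]
    · rw [AddSubgroup.zmultiples_le]
      exact AddSubgroup.torsionBy.nsmul_iff.mpr (five_nsmul_T m n)
  rw [h, Nat.card_zmultiples, addOrderOf_T]

include hq5 hq11 hq in
/-- **A rational point `P = (x, y)` of `E_{m,n}` with `x ∉ {0, mn}` has `25 P ≠ O`** (else
`P ∈ E(ℚ)[25] = ⟨T⟩`). [cite: SilvermanAEC2009, VII.3 Prop. 3.1(b)] -/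
theorem twentyfive_nsmul_ne_zero {x y : ℚ} {h : (kubertTateFive (m : ℚ) (n : ℚ)).toAffine.Nonsingular x y}
    (hx0 : x ≠ 0) (hx : x ≠ m * n) : (25 : ℕ) • Affine.Point.some x y h ≠ 0 := by
  have hnot : Affine.Point.some x y h ∉
      AddSubgroup.zmultiples (Affine.Point.some 0 0 (nonsingular_zero m n)) := fun hm ↦ by
    rcases x_eq_of_mem_zmultiples_T m n hm with h0 | hmn
    · exact hx0 h0
    · exact hx hmn
  rw [← torsionBy_twentyfive_eq m n q hq5 hq11 hq] at hnot
  exact fun h' ↦ hnot (AddSubgroup.torsionBy.nsmul_iff.mpr h')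

include hq5 hq11 hq in
/-- The same in `E(ℚ̄)`: **`25 · ι_*(P) ≠ O`** for a rational point `P = (x, y)` with `x ∉ {0, mn}` —
the reference-point hypothesis `((25 : ℕ) : ℤ) • P₁ ≠ 0` of the `μ₅`-descent engine
`KubertTateMuDescent`. [cite: SilvermanAEC2009, VIII.§1] -/
theorem twentyfive_zsmul_toGeomPoints_ne_zero {x y : ℚ}
    {h : (kubertTateFive (m : ℚ) (n : ℚ)).toAffine.Nonsingular x y} (hx0 : x ≠ 0) (hx : x ≠ m * n) :
    ((25 : ℕ) : ℤ) • toGeomPoints (kubertTateFive (m : ℚ) (n : ℚ)) (Affine.Point.some x y h) ≠ 0 := by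
  intro h'
  refine twentyfive_nsmul_ne_zero m n q hq5 hq11 hq (h := h) hx0 hx
    (toGeomPoints_injective (kubertTateFive (m : ℚ) (n : ℚ)) ?_)
  rw [(toGeomPoints (kubertTateFive (m : ℚ) (n : ℚ))).map_nsmul, map_zero, ← natCast_zsmul]
  exact h'

end Geom

end KubertTateFiveTorsion

end Literature.NumberTheory.EllipticCurves

end
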